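import Mathlib

/-!
# A quadratic extension with a non-trivial automorphism: the automorphism is an involution, its
  fixed field is the base, and the extension is Galois

`F ⊆ E` fields with `[E : F] = 2` and `σ : E ≃ₐ[F] E`, `σ ≠ 1`.  Artin's fixed-field dimension
count (`IntermediateField.finrank_fixedField_eq_card`) with the tower law gives
`[E : E^{Aut}] = |Aut(E/F)| ≥ 2 = [E : F]`, so `E^{Aut} = F`, `|Aut(E/F)| = 2 = {1, σ}`, hence

* `apply_apply`: `σ (σ a) = a`;
* `mem_range_of_fixed`: `σ z = z ⇒ z ∈ F` (the fixed elements come from the base);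
* `isGalois`: `E/F` is Galois.

These are the three hypotheses `hσσ`, `hfix` (and the Galois background) that
`T5ResidueConjugate` / `T5AdicCompletionIntegralBasis` take on the conjugation of a quadratic
extension — discharged at the FIELD level from `σ ≠ 1` alone.

Declaration per README §8(d): «uses an L-value-free non-vanishing device: NO».
-/

namespace Summit.Ventures.HodgeRepro2.T5QuadraticAutomorphism

open IntermediateField

variable {F E : Type*} [Field F] [Field E] [Algebra F E] [FiniteDimensional F E]

/-- A non-trivial automorphism gives `|Aut(E/F)| ≥ 2`. -/
theorem two_le_card_aut (σ : E ≃ₐ[F] E) (hσ : σ ≠ 1) : 2 ≤ Nat.card (E ≃ₐ[F] E) := by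
  haveI : Nontrivial (E ≃ₐ[F] E) := ⟨⟨σ, 1, hσ⟩⟩
  have := Finite.one_lt_card_iff_nontrivial.2 this
  omega

/-- Artin: `[E : E^{Aut}] = |Aut(E/F)|`. -/
theorem finrank_fixedField_top : Module.finrank (fixedField (⊤ : Subgroup (E ≃ₐ[F] E))) E =
    Nat.card (E ≃ₐ[F] E) := by
  rw [finrank_fixedField_eq_card, Subgroup.card_top]

/-- `[E : F] = 2` and a non-trivial automorphism ⇒ `[E^{Aut} : F] = 1`. -/
theorem finrank_fixedField_top_eq_one (h2 : Module.finrank F E = 2) (σ : E ≃ₐ[F] E) (hσ : σ ≠ 1) :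
    Module.finrank F (fixedField (⊤ : Subgroup (E ≃ₐ[F] E))) = 1 := by
  have hcard := two_le_card_aut σ hσ
  have htower := Module.finrank_mul_finrank F (fixedField (⊤ : Subgroup (E ≃ₐ[F] E))) E
  rw [h2, finrank_fixedField_top] at htower
  have hpos : 0 < Module.finrank F (fixedField (⊤ : Subgroup (E ≃ₐ[F] E))) :=
    Module.finrank_pos
  have hle : Module.finrank F (fixedField (⊤ : Subgroup (E ≃ₐ[F] E))) * 2 ≤ 2 := by
    calc Module.finrank F (fixedField (⊤ : Subgroup (E ≃ₐ[F] E))) * 2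
        ≤ Module.finrank F (fixedField (⊤ : Subgroup (E ≃ₐ[F] E))) * Nat.card (E ≃ₐ[F] E) :=
          Nat.mul_le_mul_left _ hcard
      _ = 2 := htower
  omega

/-- `[E : F] = 2` and a non-trivial automorphism ⇒ the fixed field of ALL automorphisms is `F`. -/
theorem fixedField_top_eq_bot (h2 : Module.finrank F E = 2) (σ : E ≃ₐ[F] E) (hσ : σ ≠ 1) :
    fixedField (⊤ : Subgroup (E ≃ₐ[F] E)) = ⊥ :=
  finrank_eq_one_iff.1 (finrank_fixedField_top_eq_one h2 σ hσ)

/-- `|Aut(E/F)| = 2`. -/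
theorem card_aut_eq_two (h2 : Module.finrank F E = 2) (σ : E ≃ₐ[F] E) (hσ : σ ≠ 1) :
    Nat.card (E ≃ₐ[F] E) = 2 := by
  have htower := Module.finrank_mul_finrank F (fixedField (⊤ : Subgroup (E ≃ₐ[F] E))) E
  rw [h2, finrank_fixedField_top, finrank_fixedField_top_eq_one h2 σ hσ, one_mul] at htower
  exact htower

/-- `Aut(E/F) = {1, σ}`. -/
theorem eq_one_or_eq (h2 : Module.finrank F E = 2) (σ : E ≃ₐ[F] E) (hσ : σ ≠ 1)
    (τ : E ≃ₐ[F] E) : τ = 1 ∨ τ = σ := by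
  obtain ⟨y, _, huniq⟩ := (Nat.card_eq_two_iff' (1 : E ≃ₐ[F] E)).1 (card_aut_eq_two h2 σ hσ)
  by_cases hτ : τ = 1
  · exact Or.inl hτ
  · exact Or.inr (by rw [huniq τ hτ, huniq σ hσ])

/-- The non-trivial automorphism of a quadratic extension is an INVOLUTION. -/
theorem apply_apply (h2 : Module.finrank F E = 2) (σ : E ≃ₐ[F] E) (hσ : σ ≠ 1) (a : E) :
    σ (σ a) = a := by
  rcases eq_one_or_eq h2 σ hσ (σ * σ) with h | h
  · have := congrArg (fun f : E ≃ₐ[F] E => f a) h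
    simpa [AlgEquiv.mul_apply] using this
  · exact absurd (mul_eq_left.1 h) hσ

/-- The FIXED ELEMENTS of the non-trivial automorphism come from the base field. -/
theorem mem_range_of_fixed (h2 : Module.finrank F E = 2) (σ : E ≃ₐ[F] E) (hσ : σ ≠ 1) {z : E}
    (hz : σ z = z) : z ∈ Set.range (algebraMap F E) := by
  rw [← mem_bot, ← fixedField_top_eq_bot h2 σ hσ, mem_fixedField_iff]
  intro τ _
  rcases eq_one_or_eq h2 σ hσ τ with h | h
  · rw [h, AlgEquiv.one_apply]
  · rw [h, hz]

/-- A quadratic extension with a non-trivial automorphism is Galois. -/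
theorem isGalois (h2 : Module.finrank F E = 2) (σ : E ≃ₐ[F] E) (hσ : σ ≠ 1) : IsGalois F E :=
  (IsGalois.tfae.out 1 0).1 (fixedField_top_eq_bot h2 σ hσ)

/-- Packaging for the integral-basis files: `σ ≠ 1` ⇒ `σ ∘ σ = id` and the fixed elements are the
base. -/
theorem involutive_and_fixed (h2 : Module.finrank F E = 2) (σ : E ≃ₐ[F] E) (hσ : σ ≠ 1) :
    (∀ a, σ (σ a) = a) ∧ ∀ z, σ z = z → z ∈ Set.range (algebraMap F E) :=
  ⟨apply_apply h2 σ hσ, fun _ hz => mem_range_of_fixed h2 σ hσ hz⟩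

end Summit.Ventures.HodgeRepro2.T5QuadraticAutomorphism
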